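import Mathlib
import Literature.NumberTheory.Transcendental.PeriodsWave0
import HarnessLib

/-!
# Apéry-like series for odd zeta values: Koecher, Almkvist–Granville, Cohen–Rivoal, Tauraso

Topic `Literature/NumberTheory/ZetaValues`. Generating-function identities of "Apéry-like" shape (fast central-binomial
series) for `ζ(2r+4s+3)` and `ζ(2+r+2s)`, and the explicit formulae for `ζ(5)`, `ζ(7)` they contain. Sources, read on the
page this session:

* T. Rivoal, *Simultaneous generation of Koecher and Almkvist–Granville's Apéry-like formulae*, Experiment. Math. **13**
  (2004) 503–508 [Rivoal2004] (Project Euclid scan `em/1109106442`, pp. 503–505): formulas (1–1)–(1–5), Theorem 1.1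
  (the identity H. Cohen predicted from Pari computations, proved there) and Theorem 1.2.
* R. Tauraso, *A bivariate generating function for zeta values and related supercongruences*, J. Difference Equ. Appl.
  **26** (2020) 1526–1537 = arXiv:1806.00846 [Tauraso2020], §1 formulas (1)–(4) and §3 Theorem 1 with its printed
  Wilf–Zeilberger certificate.
* J. Borwein, D. Bailey, R. Girgensohn, *Experimentation in Mathematics* (2004) [BorweinBaileyGirgensohn2004], §3.2.2
  pp. 95–97: (3.19), Theorem 3.2 = (3.20), (3.22).
* Primary attributions as printed there: [Koecher1980] (and Leshchiner 1981) for (1–2) and the `ζ(5)` formula,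
  [BorweinBradley1997] (experimental discovery) and [AlmkvistGranville1999] (proof) for (1–3).

HONEST FRAMING (cells pub-zeta5 / zeta5-irr): these are IDENTITIES, not diophantine approximations — Rivoal, p. 503:
"Formula (1–1) is not essential in Apéry's proof since truncations of this series are not diophantine approximations to
`ζ(3)`"; Borwein–Bailey–Girgensohn p. 95 record that PSLQ excludes `ζ(5) = (p/q) Σ (−1)^{k+1}/(k⁵ C(2k,k))` with `q` of
any reasonable size. Nothing here is an irrationality statement.

## What is printed and what is typed

* [Rivoal2004, Theorem 1.1, p. 504] "Let `a` and `b` be complex numbers such that `|a|² + |b|⁴ < 1`. Then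
  `Σ_{n≥1} n/(n⁴ − a²n² − b⁴) = ½ Σ_{k≥1} ((−1)^{k+1}/C(2k,k)) (1/k) (5k² − a²)/(k⁴ − a²k² − b⁴)
  ∏_{n=1}^{k−1} ((n² − a²)² + 4b⁴)/(n⁴ − a²n² − b⁴)`." NAMED FACT `rivoal2004_theorem11` (also [Tauraso2020, (1)],
  with the remark that it was proved independently by D. Bradley 2008). The left-hand side is the generating function
  `Σ_{r,s≥0} C(r+s,r) ζ(2r+4s+3) a^{2r} b^{4s}` (p. 504; not typed).
* [Rivoal2004, (1–2), p. 504; Koecher1980] "Koecher (and independently Leshchiner …) proved that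
  `Σ_{n≥1} 1/(n(n²−a²)) = ½ Σ_{k≥1} ((−1)^{k+1}/(C(2k,k)k³)) (5k²−a²)/(k²−a²) ∏_{n=1}^{k−1}(1 − a²/n²)` for any complex
  number `a` such that `|a| < 1`" — PROVED here from `rivoal2004_theorem11` (case `b = 0`, termwise algebra):
  `koecher_of_theorem11`.
* [Rivoal2004, (1–3), p. 504; AlmkvistGranville1999; BorweinBaileyGirgensohn2004 Thm 3.2] "Almkvist and Granville proved
  another identity, first [found experimentally] by Borwein and Bradley:
  `Σ_{n≥1} n/(n⁴−b⁴) = ½ Σ_{k≥1} ((−1)^{k+1}/C(2k,k)) (5k/(k⁴−b⁴)) ∏_{n=1}^{k−1} (n⁴+4b⁴)/(n⁴−b⁴)` for any complex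
  number `b` such that `|b| < 1`" — PROVED here from `rivoal2004_theorem11` (case `a = 0`): `almkvistGranville_of_theorem11`.
* [Koecher1980; BorweinBaileyGirgensohn2004 (3.22) p. 97; Tauraso2020 (3)]
  "`ζ(5) = 2 Σ_{k≥1} (−1)^{k+1}/(k⁵ C(2k,k)) − (5/2) Σ_{k≥1} ((−1)^{k+1}/(k³ C(2k,k))) Σ_{j=1}^{k−1} 1/j²`."
  NAMED FACT `zeta_five_apery_like` (the coefficient of `a²` in (1–2); typed with the tree's real `zetaValue 5`).
* [BorweinBaileyGirgensohn2004 (3.19) p. 96; Rivoal2004 p. 504]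
  "`ζ(7) = (5/2) Σ_{k≥1} (−1)^{k+1}/(k⁷ C(2k,k)) + (25/2) Σ_{k≥1} ((−1)^{k+1}/(k³ C(2k,k))) Σ_{j=1}^{k−1} 1/j⁴`."
  NAMED FACT `zeta_seven_apery_like` (the coefficient of `b⁴` in (1–3)). (Rivoal's second `ζ(7)` formula from (1–2) and
  his new `ζ(9)` formula, p. 504, are not typed.)
* [Rivoal2004, Theorem 1.2, p. 505] "Let `g(X) ∈ ℂ[X]` be of degree at most `2`. For any integer `n ≥ 1` and any complex
  numbers `a` and `t`, with `a ∉ {±1, ±2, …, ±n}`, we have that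
  `Σ_{k=1}^{n} (−1)^{n−k} C(2n, n−k) (4k²/(k²−a²)) (∏_{0≤j<n−k or n<j<n+k} (t(k²−a²) + g(j)) − ∏_{same j} g(j)) = 0`."
  NAMED FACT `rivoal2004_theorem12` (for `a = 0` "the key identity proved in [Almkvist and Granville 99]").
* [Tauraso2020, (2) = (GF2), §1] "`Σ_{k≥1} 1/(k² − ak − b²) = Σ_{k≥1} ((3k−a)/(k C(2k,k))) ∏_{j=1}^{k−1}(j²−a²−4b²) /
  ∏_{j=1}^{k}(j²−aj−b²)`, where the left-hand side is the generating function of `ζ(2+r+2s)`" (for `a = 0` the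
  Bailey–Borwein–Bradley 2006 generating function of `ζ(2s+2)`). NAMED FACT `tauraso2020_bivariate`, typed for complex
  `a, b` with `|a| + |b|² < 1` (a domain on which no denominator vanishes and both sides converge absolutely; the source
  states it as a generating-function identity).
* [Tauraso2020, §3 Theorem 1, first display] "For any positive integer `n`,
  `Σ_{k=1}^{n} C(2k,k)(3k−2n+z) ∏_{j=1}^{k−1}(j−n)(j−n+z) / ∏_{j=1}^{k}(j²−z²) = 2/(n−z)`." PROVED here
  (`tauraso2020_theorem1`) over any field of characteristic `0`, for `z` with `z² ∉ {1², …, n²}` (the printed rational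
  identity in `z`), following the printed Wilf–Zeilberger pair `F(n,k) = C(2k,k)(3k−2n+z)∏_{j=0}^{k−1}(j−n)(j−n+z)/∏(j²−z²)`,
  `G(n,k) = k(k²−z²)F(n,k)/((2n−3k−z)(n+1−k)(n+1−k−z))`, `S_n = Σ_k F(n,k) = 2n`, `G(n,1) = −2`; the only deviation is
  that the telescoping is stopped at `k = n−1` and the `k = n, n+1` boundary terms are verified directly (the printed
  `G(n,n+1)` is the indeterminate `0/0`). The second display of Theorem 1 (an infinite series identity) is not typed.

* [Tauraso2025, §1 (display after (KL))] the coefficientwise form of (1–2): "which implies, for `r ≥ 0`,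
  `ζ(2r+3) = Σ_{k≥1} ((−1)^{k−1−r}/(k³ C(2k,k))) ((5/2) H_{k−1}({2}^r) + 2 Σ_{j=1}^{r} ((−1)^j/k^{2j}) H_{k−1}({2}^{r−j}))`
  where `H_k({2}^s) = Σ_{1≤j₁<⋯<j_s≤k} 1/(j₁²⋯j_s²)`" — an explicit Apéry-like series for EVERY odd zeta value
  (`r = 0`: (1–1); `r = 1`: Koecher's `ζ(5)`). NAMED FACT `koecherLeshchiner_oddZeta` (appended 2026-08-27; the
  `q`-analogue that is the subject of [Tauraso2025] is not typed).

Conventions: all infinite sums are written over `k + 1`, `k : ℕ`, so that no junk `1/0` term is involved; `C(2k,k)` is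
Mathlib's `Nat.centralBinom`.
-/

noncomputable section

open Finset
open scoped BigOperators

namespace Literature.NumberTheory.ZetaValues

/-! ### The Cohen–Rivoal bivariate identity and its two classical specialisations -/

/-- The general term of the right-hand side of Rivoal's (1–4) at index `k ≥ 1`:
`((−1)^{k+1}/C(2k,k)) · (1/k) · (5k² − a²)/(k⁴ − a²k² − b⁴) · ∏_{n=1}^{k−1} ((n²−a²)² + 4b⁴)/(n⁴ − a²n² − b⁴)`.
[cite: Rivoal2004, Theorem 1.1 (1–4) p. 504] -/
def rivoalTerm (a b : ℂ) (k : ℕ) : ℂ :=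
  (-1) ^ (k + 1) / (k.centralBinom : ℂ) * (1 / (k : ℂ)) *
      ((5 * (k : ℂ) ^ 2 - a ^ 2) / ((k : ℂ) ^ 4 - a ^ 2 * (k : ℂ) ^ 2 - b ^ 4)) *
    ∏ n ∈ Finset.Ico 1 k, (((n : ℂ) ^ 2 - a ^ 2) ^ 2 + 4 * b ^ 4) / ((n : ℂ) ^ 4 - a ^ 2 * (n : ℂ) ^ 2 - b ^ 4)

/-- **Rivoal 2004, Theorem 1.1** (the identity predicted by H. Cohen, PROVED in the source; NAMED FACT here). For complex `a, b` with `|a|² + |b|⁴ < 1`,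
`Σ_{n≥1} n/(n⁴ − a²n² − b⁴) = ½ Σ_{k≥1} ((−1)^{k+1}/C(2k,k)) (1/k) (5k²−a²)/(k⁴−a²k²−b⁴) ∏_{n<k}((n²−a²)²+4b⁴)/(n⁴−a²n²−b⁴)`
(the left-hand side is `Σ_{r,s≥0} C(r+s,r) ζ(2r+4s+3) a^{2r}b^{4s}`). Also proved by D. Bradley (2008) and restated as
[Tauraso2020, (1)]. [cite: Rivoal2004, Theorem 1.1 p. 504] -/
def rivoal2004_theorem11 : Prop :=
  ∀ a b : ℂ, ‖a‖ ^ 2 + ‖b‖ ^ 4 < 1 →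
    ∑' n : ℕ, ((n + 1 : ℕ) : ℂ) / (((n + 1 : ℕ) : ℂ) ^ 4 - a ^ 2 * ((n + 1 : ℕ) : ℂ) ^ 2 - b ^ 4) =
      (1 / 2 : ℂ) * ∑' k : ℕ, rivoalTerm a b (k + 1)

/-- For `|a| < 1` and `n ≥ 1`, `n² − a² ≠ 0` in `ℂ`. [folklore] -/
private theorem natCast_sq_sub_sq_ne_zero {a : ℂ} (ha : ‖a‖ < 1) {n : ℕ} (hn : 1 ≤ n) :
    (n : ℂ) ^ 2 - a ^ 2 ≠ 0 := by
  intro h0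
  have heq : a ^ 2 = (n : ℂ) ^ 2 := by linear_combination -h0
  have h1 : ‖a ^ 2‖ < 1 := by
    rw [norm_pow]
    exact pow_lt_one₀ (norm_nonneg _) ha two_ne_zero
  have h2 : (1 : ℝ) ≤ ‖(n : ℂ) ^ 2‖ := by
    rw [norm_pow, Complex.norm_natCast]
    exact one_le_pow₀ (by exact_mod_cast hn)
  rw [heq] at h1
  linarith

/-- For `|b| < 1` and `n ≥ 1`, `n⁴ − b⁴ ≠ 0` in `ℂ`. [folklore] -/
private theorem natCast_pow_four_sub_ne_zero {b : ℂ} (hb : ‖b‖ < 1) {n : ℕ} (hn : 1 ≤ n) :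
    (n : ℂ) ^ 4 - b ^ 4 ≠ 0 := by
  intro h0
  have heq : b ^ 4 = (n : ℂ) ^ 4 := by linear_combination -h0
  have h1 : ‖b ^ 4‖ < 1 := by
    rw [norm_pow]
    exact pow_lt_one₀ (norm_nonneg _) hb (by norm_num)
  have h2 : (1 : ℝ) ≤ ‖(n : ℂ) ^ 4‖ := by
    rw [norm_pow, Complex.norm_natCast]
    exact one_le_pow₀ (by exact_mod_cast hn)
  rw [heq] at h1
  linarith

/-- **Koecher 1980 / Leshchiner 1981, the generating function of `ζ(2s+3)`** ([Rivoal2004, (1–2)]): for complex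
`|a| < 1`, `Σ_{n≥1} 1/(n(n²−a²)) = ½ Σ_{k≥1} ((−1)^{k+1}/(C(2k,k)k³)) (5k²−a²)/(k²−a²) ∏_{n=1}^{k−1}(1 − a²/n²)`.
PROVED from `rivoal2004_theorem11` (its case `b = 0`, where `((n²−a²)²)/(n⁴−a²n²) = 1 − a²/n²` and
`n/(n⁴−a²n²) = 1/(n(n²−a²))`). [cite: Rivoal2004, (1–2) p. 504] -/
theorem koecher_of_theorem11 (h : rivoal2004_theorem11) (a : ℂ) (ha : ‖a‖ < 1) :
    ∑' n : ℕ, 1 / (((n + 1 : ℕ) : ℂ) * (((n + 1 : ℕ) : ℂ) ^ 2 - a ^ 2)) =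
      (1 / 2 : ℂ) * ∑' k : ℕ,
        (-1) ^ (k + 2) / (((k + 1).centralBinom : ℂ) * ((k + 1 : ℕ) : ℂ) ^ 3) *
          ((5 * ((k + 1 : ℕ) : ℂ) ^ 2 - a ^ 2) / (((k + 1 : ℕ) : ℂ) ^ 2 - a ^ 2)) *
          ∏ n ∈ Finset.Ico 1 (k + 1), (1 - a ^ 2 / (n : ℂ) ^ 2) := by
  have hab : ‖a‖ ^ 2 + ‖(0 : ℂ)‖ ^ 4 < 1 := by
    have h0 := norm_nonneg a
    have h1 : ‖a‖ ^ 2 < 1 := by nlinarith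
    simpa using h1
  have hmain := h a 0 hab
  have hL : ∀ n : ℕ,
      1 / (((n + 1 : ℕ) : ℂ) * (((n + 1 : ℕ) : ℂ) ^ 2 - a ^ 2)) =
        ((n + 1 : ℕ) : ℂ) / (((n + 1 : ℕ) : ℂ) ^ 4 - a ^ 2 * ((n + 1 : ℕ) : ℂ) ^ 2 - (0 : ℂ) ^ 4) := fun n => by
    have hn : ((n + 1 : ℕ) : ℂ) ≠ 0 := by exact_mod_cast Nat.succ_ne_zero n
    have hs := natCast_sq_sub_sq_ne_zero ha (n := n + 1) (by omega)
    have hden : ((n + 1 : ℕ) : ℂ) ^ 4 - a ^ 2 * ((n + 1 : ℕ) : ℂ) ^ 2 - (0 : ℂ) ^ 4 =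
        ((n + 1 : ℕ) : ℂ) ^ 2 * (((n + 1 : ℕ) : ℂ) ^ 2 - a ^ 2) := by ring
    rw [hden, div_eq_div_iff (mul_ne_zero hn hs) (mul_ne_zero (pow_ne_zero 2 hn) hs)]
    ring
  have hR : ∀ k : ℕ, rivoalTerm a 0 (k + 1) =
      (-1) ^ (k + 2) / (((k + 1).centralBinom : ℂ) * ((k + 1 : ℕ) : ℂ) ^ 3) *
          ((5 * ((k + 1 : ℕ) : ℂ) ^ 2 - a ^ 2) / (((k + 1 : ℕ) : ℂ) ^ 2 - a ^ 2)) *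
          ∏ n ∈ Finset.Ico 1 (k + 1), (1 - a ^ 2 / (n : ℂ) ^ 2) := fun k => by
    have hK : ((k + 1 : ℕ) : ℂ) ≠ 0 := by exact_mod_cast Nat.succ_ne_zero k
    have hC : (((k + 1).centralBinom : ℕ) : ℂ) ≠ 0 := by exact_mod_cast (Nat.centralBinom_pos (k + 1)).ne'
    have hs := natCast_sq_sub_sq_ne_zero ha (n := k + 1) (by omega)
    have hprod : ∏ n ∈ Finset.Ico 1 (k + 1),
        (((n : ℂ) ^ 2 - a ^ 2) ^ 2 + 4 * (0 : ℂ) ^ 4) / ((n : ℂ) ^ 4 - a ^ 2 * (n : ℂ) ^ 2 - (0 : ℂ) ^ 4) =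
        ∏ n ∈ Finset.Ico 1 (k + 1), (1 - a ^ 2 / (n : ℂ) ^ 2) := by
      refine Finset.prod_congr rfl fun n hn => ?_
      have hn1 : 1 ≤ n := (Finset.mem_Ico.1 hn).1
      have hn0 : (n : ℂ) ≠ 0 := by exact_mod_cast (show n ≠ 0 by omega)
      have hs' := natCast_sq_sub_sq_ne_zero ha hn1
      have hden : (n : ℂ) ^ 4 - a ^ 2 * (n : ℂ) ^ 2 - (0 : ℂ) ^ 4 = (n : ℂ) ^ 2 * ((n : ℂ) ^ 2 - a ^ 2) := by ring
      rw [hden, div_eq_iff (mul_ne_zero (pow_ne_zero 2 hn0) hs')]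
      field_simp
      ring
    unfold rivoalTerm
    rw [hprod]
    congr 1
    have hden : ((k + 1 : ℕ) : ℂ) ^ 4 - a ^ 2 * ((k + 1 : ℕ) : ℂ) ^ 2 - (0 : ℂ) ^ 4 =
        ((k + 1 : ℕ) : ℂ) ^ 2 * (((k + 1 : ℕ) : ℂ) ^ 2 - a ^ 2) := by ring
    rw [hden, show k + 1 + 1 = k + 2 by ring]
    field_simp
  calc ∑' n : ℕ, 1 / (((n + 1 : ℕ) : ℂ) * (((n + 1 : ℕ) : ℂ) ^ 2 - a ^ 2))
      = ∑' n : ℕ, ((n + 1 : ℕ) : ℂ) / (((n + 1 : ℕ) : ℂ) ^ 4 - a ^ 2 * ((n + 1 : ℕ) : ℂ) ^ 2 - (0 : ℂ) ^ 4) :=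
        tsum_congr hL
    _ = (1 / 2 : ℂ) * ∑' k : ℕ, rivoalTerm a 0 (k + 1) := hmain
    _ = _ := by rw [tsum_congr hR]

/-- **Almkvist–Granville 1999 (discovered experimentally by Borwein–Bradley 1997), the generating function of `ζ(4s+3)`**
([Rivoal2004, (1–3)]; [BorweinBaileyGirgensohn2004, Theorem 3.2]): for complex `|b| < 1`,
`Σ_{n≥1} n/(n⁴−b⁴) = ½ Σ_{k≥1} ((−1)^{k+1}/C(2k,k)) (5k/(k⁴−b⁴)) ∏_{n=1}^{k−1} (n⁴+4b⁴)/(n⁴−b⁴)`. PROVED from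
`rivoal2004_theorem11` (its case `a = 0`). [cite: Rivoal2004, (1–3) p. 504] [cite: AlmkvistGranville1999, Theorem (the Borwein–Bradley formula)] -/
theorem almkvistGranville_of_theorem11 (h : rivoal2004_theorem11) (b : ℂ) (hb : ‖b‖ < 1) :
    ∑' n : ℕ, ((n + 1 : ℕ) : ℂ) / (((n + 1 : ℕ) : ℂ) ^ 4 - b ^ 4) =
      (1 / 2 : ℂ) * ∑' k : ℕ,
        (-1) ^ (k + 2) / ((k + 1).centralBinom : ℂ) * (5 * ((k + 1 : ℕ) : ℂ) / (((k + 1 : ℕ) : ℂ) ^ 4 - b ^ 4)) *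
          ∏ n ∈ Finset.Ico 1 (k + 1), ((n : ℂ) ^ 4 + 4 * b ^ 4) / ((n : ℂ) ^ 4 - b ^ 4) := by
  have hab : ‖(0 : ℂ)‖ ^ 2 + ‖b‖ ^ 4 < 1 := by
    have h0 := norm_nonneg b
    have h1 : ‖b‖ ^ 4 < 1 := pow_lt_one₀ h0 hb (by norm_num)
    simpa using h1
  have hmain := h 0 b hab
  have hL : ∀ n : ℕ, ((n + 1 : ℕ) : ℂ) / (((n + 1 : ℕ) : ℂ) ^ 4 - b ^ 4) =
      ((n + 1 : ℕ) : ℂ) / (((n + 1 : ℕ) : ℂ) ^ 4 - (0 : ℂ) ^ 2 * ((n + 1 : ℕ) : ℂ) ^ 2 - b ^ 4) := fun n => by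
    ring
  have hR : ∀ k : ℕ, rivoalTerm 0 b (k + 1) =
      (-1) ^ (k + 2) / ((k + 1).centralBinom : ℂ) * (5 * ((k + 1 : ℕ) : ℂ) / (((k + 1 : ℕ) : ℂ) ^ 4 - b ^ 4)) *
        ∏ n ∈ Finset.Ico 1 (k + 1), ((n : ℂ) ^ 4 + 4 * b ^ 4) / ((n : ℂ) ^ 4 - b ^ 4) := fun k => by
    have hK : ((k + 1 : ℕ) : ℂ) ≠ 0 := by exact_mod_cast Nat.succ_ne_zero k
    have hprod : ∏ n ∈ Finset.Ico 1 (k + 1),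
        (((n : ℂ) ^ 2 - (0 : ℂ) ^ 2) ^ 2 + 4 * b ^ 4) / ((n : ℂ) ^ 4 - (0 : ℂ) ^ 2 * (n : ℂ) ^ 2 - b ^ 4) =
        ∏ n ∈ Finset.Ico 1 (k + 1), ((n : ℂ) ^ 4 + 4 * b ^ 4) / ((n : ℂ) ^ 4 - b ^ 4) :=
      Finset.prod_congr rfl fun n _ => by ring
    have hden : ((k + 1 : ℕ) : ℂ) ^ 4 - b ^ 4 ≠ 0 := natCast_pow_four_sub_ne_zero hb (n := k + 1) (by omega)
    unfold rivoalTerm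
    rw [hprod, show k + 1 + 1 = k + 2 by ring]
    congr 1
    have : ((k + 1 : ℕ) : ℂ) ^ 4 - (0 : ℂ) ^ 2 * ((k + 1 : ℕ) : ℂ) ^ 2 - b ^ 4 = ((k + 1 : ℕ) : ℂ) ^ 4 - b ^ 4 := by
      ring
    rw [this]
    field_simp
    ring
  calc ∑' n : ℕ, ((n + 1 : ℕ) : ℂ) / (((n + 1 : ℕ) : ℂ) ^ 4 - b ^ 4)
      = ∑' n : ℕ, ((n + 1 : ℕ) : ℂ) / (((n + 1 : ℕ) : ℂ) ^ 4 - (0 : ℂ) ^ 2 * ((n + 1 : ℕ) : ℂ) ^ 2 - b ^ 4) :=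
        tsum_congr hL
    _ = (1 / 2 : ℂ) * ∑' k : ℕ, rivoalTerm 0 b (k + 1) := hmain
    _ = _ := by rw [tsum_congr hR]

/-! ### The explicit formulae for `ζ(5)` and `ζ(7)` -/

/-- **Koecher's formula for `ζ(5)`** (NAMED FACT; the coefficient of `a²` in (1–2)):
`ζ(5) = 2 Σ_{k≥1} (−1)^{k+1}/(k⁵ C(2k,k)) − (5/2) Σ_{k≥1} ((−1)^{k+1}/(k³ C(2k,k))) Σ_{j=1}^{k−1} j^{−2}`
(`= ½ Σ_{k≥1} ((−1)^{k−1}/C(2k,k)) (4/k⁵ − 5H_{k−1}(2)/k³)` in [Tauraso2020, (3)]).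
[cite: BorweinBaileyGirgensohn2004, §3.2.2 (3.22) p. 97] [cite: Koecher1980, (formula for ζ(5))] [cite: Tauraso2020, (3)] -/
def zeta_five_apery_like : Prop :=
  Literature.NumberTheory.Transcendental.zetaValue 5 =
    2 * ∑' k : ℕ, (-1 : ℝ) ^ (k + 2) / (((k + 1 : ℕ) : ℝ) ^ 5 * ((k + 1).centralBinom : ℝ)) -
      5 / 2 * ∑' k : ℕ, (-1 : ℝ) ^ (k + 2) / (((k + 1 : ℕ) : ℝ) ^ 3 * ((k + 1).centralBinom : ℝ)) *
        ∑ j ∈ Finset.Ico 1 (k + 1), 1 / (j : ℝ) ^ 2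

/-- **The Apéry-like formula for `ζ(7)`** (NAMED FACT; the coefficient of `b⁴` in the Borwein–Bradley /
Almkvist–Granville identity (1–3)):
`ζ(7) = (5/2) Σ_{k≥1} (−1)^{k+1}/(k⁷ C(2k,k)) + (25/2) Σ_{k≥1} ((−1)^{k+1}/(k³ C(2k,k))) Σ_{j=1}^{k−1} j^{−4}`.
[cite: BorweinBaileyGirgensohn2004, §3.2.2 (3.19) p. 96] [cite: Rivoal2004, p. 504 (display after (1–3))] -/
def zeta_seven_apery_like : Prop :=
  Literature.NumberTheory.Transcendental.zetaValue 7 =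
    5 / 2 * ∑' k : ℕ, (-1 : ℝ) ^ (k + 2) / (((k + 1 : ℕ) : ℝ) ^ 7 * ((k + 1).centralBinom : ℝ)) +
      25 / 2 * ∑' k : ℕ, (-1 : ℝ) ^ (k + 2) / (((k + 1 : ℕ) : ℝ) ^ 3 * ((k + 1).centralBinom : ℝ)) *
        ∑ j ∈ Finset.Ico 1 (k + 1), 1 / (j : ℝ) ^ 4

/-! ### Rivoal's finite identity (Theorem 1.2) -/

/-- The index set `{j : 0 ≤ j < n − k or n < j < n + k}` of [Rivoal2004, (1–5)]. [cite: Rivoal2004, Theorem 1.2 p. 505] -/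
def rivoalIndexSet (n k : ℕ) : Finset ℕ := Finset.range (n - k) ∪ Finset.Ioo n (n + k)

/-- **Rivoal 2004, Theorem 1.2** (NAMED FACT). "Let `g(X) ∈ ℂ[X]` be of degree at most `2`. For any integer `n ≥ 1`
and any complex numbers `a` and `t`, with `a ∉ {±1, ±2, …, ±n}`,
`Σ_{k=1}^{n} (−1)^{n−k} C(2n, n−k) (4k²/(k²−a²)) (∏_{0≤j<n−k or n<j<n+k} (t(k²−a²) + g(j)) − ∏_{0≤j<n−k or n<j<n+k} g(j))
= 0`." (For `a = 0` this is the key identity of Almkvist–Granville.) [cite: Rivoal2004, Theorem 1.2 (1–5) p. 505] -/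
def rivoal2004_theorem12 : Prop :=
  ∀ (g : Polynomial ℂ), g.natDegree ≤ 2 → ∀ (n : ℕ), 1 ≤ n → ∀ (a t : ℂ),
    (∀ j ∈ Finset.Icc 1 n, a ≠ (j : ℂ) ∧ a ≠ -(j : ℂ)) →
      ∑ k ∈ Finset.Icc 1 n, (-1 : ℂ) ^ (n - k) * ((2 * n).choose (n - k) : ℂ) *
          (4 * (k : ℂ) ^ 2 / ((k : ℂ) ^ 2 - a ^ 2)) *
          (∏ j ∈ rivoalIndexSet n k, (t * ((k : ℂ) ^ 2 - a ^ 2) + g.eval (j : ℂ)) -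
            ∏ j ∈ rivoalIndexSet n k, g.eval (j : ℂ)) = 0

/-! ### Tauraso's bivariate identity for `ζ(2+r+2s)` -/

/-- **Tauraso 2020, (2) = (GF2)** (NAMED FACT): "`Σ_{k≥1} 1/(k² − ak − b²) = Σ_{k≥1} ((3k−a)/(k C(2k,k)))
∏_{j=1}^{k−1}(j² − a² − 4b²)/∏_{j=1}^{k}(j² − aj − b²)`, where the left-hand side is the generating function
`Σ_{r,s} C(r+s,r) ζ(2+r+2s) a^r b^{2s}`" — for `a = 0` the Bailey–Borwein–Bradley (2006) generating function of the even
zeta values, and by coefficient extraction `ζ(3) = Σ_{k≥1} (1/C(2k,k))(2/k³ + 3H_{k−1}(1)/k²)`,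
`ζ(4) = 3 Σ_{k≥1} (1/C(2k,k))(1/k⁴ − 3H_{k−1}(2)/k²)` ([Tauraso2020, (4)]; not typed). Typed for complex `a, b` with
`|a| + |b|² < 1`, where every `j² − aj − b²` (`j ≥ 1`) is non-zero and both sides converge absolutely; the source states
it as an identity of generating functions. [cite: Tauraso2020, §1 (2)] -/
def tauraso2020_bivariate : Prop :=
  ∀ a b : ℂ, ‖a‖ + ‖b‖ ^ 2 < 1 →
    ∑' k : ℕ, 1 / (((k + 1 : ℕ) : ℂ) ^ 2 - a * ((k + 1 : ℕ) : ℂ) - b ^ 2) =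
      ∑' k : ℕ, (3 * ((k + 1 : ℕ) : ℂ) - a) / (((k + 1 : ℕ) : ℂ) * ((k + 1).centralBinom : ℂ)) *
        ((∏ j ∈ Finset.Ico 1 (k + 1), ((j : ℂ) ^ 2 - a ^ 2 - 4 * b ^ 2)) /
          ∏ j ∈ Finset.Icc 1 (k + 1), ((j : ℂ) ^ 2 - a * (j : ℂ) - b ^ 2))

/-! ### Tauraso's finite identity (Theorem 1), PROVED by the printed Wilf–Zeilberger pair -/

section WZ

variable {K : Type*} [Field K] [CharZero K]

/-- `P(n,k) = ∏_{j=0}^{k−1} (j−n)(j−n+z)`, the `n`-dependent product of the WZ function `F(n,k)`.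
[cite: Tauraso2020, §3 proof of Theorem 1 (definition of F(n,k))] -/
def wzP (z : K) (n k : ℕ) : K := ∏ j ∈ Finset.range k, (((j : K) - n) * ((j : K) - n + z))

/-- `D(k) = ∏_{j=1}^{k} (j² − z²)`. [cite: Tauraso2020, §3 proof of Theorem 1 (definition of F(n,k))] -/
def wzD (z : K) (k : ℕ) : K := ∏ j ∈ Finset.range k, (((j : K) + 1) ^ 2 - z ^ 2)

/-- Tauraso's `F(n,k) = C(2k,k)(3k−2n+z) ∏_{j=0}^{k−1}(j−n)(j−n+z) / ∏_{j=1}^{k}(j²−z²)`.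
[cite: Tauraso2020, §3 proof of Theorem 1] -/
def wzF (z : K) (n k : ℕ) : K := (k.centralBinom : K) * (3 * (k : K) - 2 * n + z) * wzP z n k / wzD z k

/-- Tauraso's certificate `G(n,k) = k(k²−z²)F(n,k)/((2n−3k−z)(n+1−k)(n+1−k−z))`, written with the factor
`(3k−2n+z)/(2n−3k−z) = −1` cancelled: `G(n,k) = −k (k²−z²) C(2k,k) P(n,k) / (D(k)(n+1−k)(n+1−k−z))`.
[cite: Tauraso2020, §3 proof of Theorem 1] -/
def wzG (z : K) (n k : ℕ) : K :=
  -((k : K) * ((k : K) ^ 2 - z ^ 2) * (k.centralBinom : K) * wzP z n k) /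
    (wzD z k * ((n : K) + 1 - k) * ((n : K) + 1 - k - z))

omit [CharZero K] in
/-- `P(n,k+1) = P(n,k)·(k−n)(k−n+z)`. [cite: Tauraso2020, §3 proof of Theorem 1] -/
theorem wzP_succ (z : K) (n k : ℕ) :
    wzP z n (k + 1) = wzP z n k * (((k : K) - n) * ((k : K) - n + z)) := by
  rw [wzP, Finset.prod_range_succ, wzP]

omit [CharZero K] in
/-- `D(k+1) = D(k)·((k+1)²−z²)`. [cite: Tauraso2020, §3 proof of Theorem 1] -/
theorem wzD_succ (z : K) (k : ℕ) : wzD z (k + 1) = wzD z k * (((k : K) + 1) ^ 2 - z ^ 2) := by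
  rw [wzD, Finset.prod_range_succ, wzD]

omit [CharZero K] in
/-- The telescoping relation `P(n+1,k)(n+1−k)(n+1−k−z) = P(n,k)(n+1)(n+1−z)`. [cite: Tauraso2020, §3 proof of Theorem 1] -/
theorem wzP_succ_left (z : K) (n k : ℕ) :
    wzP z (n + 1) k * (((n : K) + 1 - k) * ((n : K) + 1 - k - z)) =
      wzP z n k * (((n : K) + 1) * ((n : K) + 1 - z)) := by
  induction k with
  | zero => simp [wzP]
  | succ k ih =>
    rw [wzP_succ, wzP_succ]
    have e : wzP z (n + 1) k * (((k : K) - ((n + 1 : ℕ) : K)) * ((k : K) - ((n + 1 : ℕ) : K) + z)) *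
          (((n : K) + 1 - ((k + 1 : ℕ) : K)) * ((n : K) + 1 - ((k + 1 : ℕ) : K) - z))
        = (wzP z (n + 1) k * (((n : K) + 1 - k) * ((n : K) + 1 - k - z))) *
          (((k : K) - n) * ((k : K) - n + z)) := by
      push_cast; ring
    rw [e, ih]
    ring

omit [CharZero K] in
/-- `D(k) ≠ 0` as long as `z² ≠ j²` for `1 ≤ j ≤ k`. [cite: Tauraso2020, §3 Theorem 1 (hypotheses)] -/
theorem wzD_ne_zero (z : K) {m k : ℕ} (hk : k ≤ m) (hz : ∀ j ∈ Finset.Icc 1 m, (j : K) ^ 2 ≠ z ^ 2) :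
    wzD z k ≠ 0 := by
  rw [wzD]
  refine Finset.prod_ne_zero_iff.2 fun j hj => ?_
  have hj' : j + 1 ∈ Finset.Icc 1 m := by
    rw [Finset.mem_Icc]; have := Finset.mem_range.1 hj; omega
  have := hz (j + 1) hj'
  push_cast at this
  exact sub_ne_zero.2 this

/-- **The Wilf–Zeilberger relation** `F(n+1,k) − F(n,k) = G(n,k+1) − G(n,k)` for `1 ≤ k ≤ n − 1` (where every
denominator is a unit). [cite: Tauraso2020, §3 proof of Theorem 1 ("(F,G) is a WZ pair")] -/
theorem wz_relation (z : K) {n k : ℕ} (hk1 : 1 ≤ k) (hkn : k + 1 ≤ n)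
    (hz : ∀ j ∈ Finset.Icc 1 n, (j : K) ^ 2 ≠ z ^ 2) :
    wzF z (n + 1) k - wzF z n k = wzG z n (k + 1) - wzG z n k := by
  -- non-vanishing of the denominators
  have hDk : wzD z k ≠ 0 := wzD_ne_zero z (by omega) hz
  have hk1' : ((k : K) + 1) ^ 2 - z ^ 2 ≠ 0 := by
    have := hz (k + 1) (by rw [Finset.mem_Icc]; omega); push_cast at this; exact sub_ne_zero.2 this
  have hcast1 : ((n + 1 - k : ℕ) : K) = (n : K) + 1 - k := by
    rw [Nat.cast_sub (by omega)]; push_cast; ring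
  have hcast2 : ((n - k : ℕ) : K) = (n : K) - k := by
    rw [Nat.cast_sub (by omega)]
  have hA : (n : K) + 1 - k ≠ 0 := by
    rw [← hcast1]; exact_mod_cast (show n + 1 - k ≠ 0 by omega)
  have hB : (n : K) + 1 - k - z ≠ 0 := by
    intro h0
    have := hz (n + 1 - k) (by rw [Finset.mem_Icc]; omega)
    apply this
    rw [hcast1, show (n : K) + 1 - k = z by linear_combination h0]
  have hA2 : (n : K) - k ≠ 0 := by
    rw [← hcast2]; exact_mod_cast (show n - k ≠ 0 by omega)
  have hB2 : (n : K) - k - z ≠ 0 := by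
    intro h0
    have := hz (n - k) (by rw [Finset.mem_Icc]; omega)
    apply this
    rw [hcast2, show (n : K) - k = z by linear_combination h0]
  have hkK : (k : K) + 1 ≠ 0 := by exact_mod_cast Nat.succ_ne_zero k
  -- central binomial recursion `(k+1) C(2k+2,k+1) = 2(2k+1) C(2k,k)`
  have hC : (((k + 1).centralBinom : ℕ) : K) = 2 * (2 * (k : K) + 1) * (k.centralBinom : K) / ((k : K) + 1) := by
    rw [eq_div_iff hkK]
    have h' : (((k + 1) * (k + 1).centralBinom : ℕ) : K) = ((2 * (2 * k + 1) * k.centralBinom : ℕ) : K) := by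
      exact_mod_cast Nat.succ_mul_centralBinom_succ k
    push_cast at h'
    linear_combination h'
  -- the telescoping relation for `P(n+1,k)`
  have hP1 : wzP z (n + 1) k =
      wzP z n k * (((n : K) + 1) * ((n : K) + 1 - z)) / (((n : K) + 1 - k) * ((n : K) + 1 - k - z)) := by
    rw [eq_div_iff (mul_ne_zero hA hB), wzP_succ_left]
  -- the four quantities as multiples of `W = C(2k,k) P(n,k) / D(k)`
  set W : K := (k.centralBinom : K) * wzP z n k / wzD z k with hW
  have eF0 : wzF z n k = (3 * (k : K) - 2 * n + z) * W := by
    simp only [wzF, hW]; ring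
  have eF1 : wzF z (n + 1) k = (3 * (k : K) - 2 * n - 2 + z) * (((n : K) + 1) * ((n : K) + 1 - z)) /
      (((n : K) + 1 - k) * ((n : K) + 1 - k - z)) * W := by
    simp only [wzF, hW]; rw [hP1]; push_cast; ring
  have eG0 : wzG z n k = -((k : K) * ((k : K) ^ 2 - z ^ 2)) / (((n : K) + 1 - k) * ((n : K) + 1 - k - z)) * W := by
    simp only [wzG, hW]
    field_simp
  have eG1 : wzG z n (k + 1) = -(2 * (2 * (k : K) + 1)) * W := by
    have hden : wzD z (k + 1) * ((n : K) + 1 - ((k + 1 : ℕ) : K)) * ((n : K) + 1 - ((k + 1 : ℕ) : K) - z) ≠ 0 := by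
      have e : wzD z (k + 1) * ((n : K) + 1 - ((k + 1 : ℕ) : K)) * ((n : K) + 1 - ((k + 1 : ℕ) : K) - z) =
          wzD z k * (((k : K) + 1) ^ 2 - z ^ 2) * (((n : K) - k) * ((n : K) - k - z)) := by
        rw [wzD_succ]; push_cast; ring
      rw [e]
      exact mul_ne_zero (mul_ne_zero hDk hk1') (mul_ne_zero hA2 hB2)
    simp only [wzG]
    rw [div_eq_iff hden, hW, wzP_succ, wzD_succ, hC]
    push_cast
    field_simp
    ring
  rw [eF0, eF1, eG0, eG1]
  field_simp
  ring

/-- `G(n,1) = −2` (for `n ≥ 1`, `z ≠ n`, `z² ≠ 1`). [cite: Tauraso2020, §3 proof of Theorem 1 ("G(n,1) = −2")] -/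
theorem wzG_one (z : K) {n : ℕ} (hn : 1 ≤ n) (hz : ∀ j ∈ Finset.Icc 1 n, (j : K) ^ 2 ≠ z ^ 2) :
    wzG z n 1 = -2 := by
  have hnz : (n : K) - z ≠ 0 := by
    intro h0
    have := hz n (by rw [Finset.mem_Icc]; omega)
    apply this; rw [show (n : K) = z by linear_combination h0]
  have hn0 : (n : K) ≠ 0 := by exact_mod_cast (show n ≠ 0 by omega)
  have h1z : (1 : K) - z ^ 2 ≠ 0 := by
    have := hz 1 (by rw [Finset.mem_Icc]; omega)
    norm_num at this
    exact sub_ne_zero.2 this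
  have hc1 : Nat.centralBinom 1 = 2 := by decide
  simp only [wzG, wzP, wzD, Finset.prod_range_one, hc1]
  push_cast
  have hden : (((0 : K) + 1) ^ 2 - z ^ 2) * ((n : K) + 1 - 1) * ((n : K) + 1 - 1 - z) ≠ 0 := by
    have e : (((0 : K) + 1) ^ 2 - z ^ 2) * ((n : K) + 1 - 1) * ((n : K) + 1 - 1 - z) =
        (1 - z ^ 2) * n * (n - z) := by ring
    rw [e]
    exact mul_ne_zero (mul_ne_zero h1z hn0) hnz
  rw [div_eq_iff hden]
  ring

/-- The boundary identity at `k = n, n + 1`: `G(n,n) + F(n+1,n) − F(n,n) + F(n+1,n+1) = 0`.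
[cite: Tauraso2020, §3 proof of Theorem 1 ("F(n,n+1) = G(n,n+2) = 0")] -/
theorem wz_boundary (z : K) {n : ℕ} (hn : 1 ≤ n) (hz : ∀ j ∈ Finset.Icc 1 (n + 1), (j : K) ^ 2 ≠ z ^ 2) :
    wzG z n n + wzF z (n + 1) n - wzF z n n + wzF z (n + 1) (n + 1) = 0 := by
  have hDn : wzD z n ≠ 0 := wzD_ne_zero z (by omega) hz
  have hn1 : ((n : K) + 1) ^ 2 - z ^ 2 ≠ 0 := by
    have := hz (n + 1) (by rw [Finset.mem_Icc]; omega); push_cast at this; exact sub_ne_zero.2 this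
  have hn1' : (n : K) + 1 - z ≠ 0 := by
    intro h0
    have := hz (n + 1) (by rw [Finset.mem_Icc]; omega)
    apply this; push_cast; rw [show (n : K) + 1 = z by linear_combination h0]
  have h1z : (1 : K) - z ≠ 0 := by
    intro h0
    have := hz 1 (by rw [Finset.mem_Icc]; omega)
    apply this; push_cast; rw [show (1 : K) = z by linear_combination h0]
  have hnK : (n : K) + 1 ≠ 0 := by exact_mod_cast Nat.succ_ne_zero n
  have hC : (((n + 1).centralBinom : ℕ) : K) = 2 * (2 * (n : K) + 1) * (n.centralBinom : K) / ((n : K) + 1) := by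
    rw [eq_div_iff hnK]
    have h' : (((n + 1) * (n + 1).centralBinom : ℕ) : K) = ((2 * (2 * n + 1) * n.centralBinom : ℕ) : K) := by
      exact_mod_cast Nat.succ_mul_centralBinom_succ n
    push_cast at h'
    linear_combination h'
  -- `P(n+1,n)` and `P(n+1,n+1)` in terms of `P(n,n)`
  have hPl := wzP_succ_left z n n
  have hP1 : wzP z (n + 1) n = wzP z n n * (((n : K) + 1) * ((n : K) + 1 - z)) / (1 - z) := by
    rw [eq_div_iff h1z, ← hPl]
    ring
  have hP2 : wzP z (n + 1) (n + 1) = wzP z n n * (((n : K) + 1) * ((n : K) + 1 - z)) := by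
    rw [wzP_succ, hP1]
    push_cast
    field_simp
    ring
  set W : K := (n.centralBinom : K) * wzP z n n / wzD z n with hW
  have eG : wzG z n n = -((n : K) * ((n : K) ^ 2 - z ^ 2)) / (1 - z) * W := by
    simp only [wzG, hW]
    rw [show (n : K) + 1 - n = 1 by ring]
    field_simp
  have eF0 : wzF z n n = ((n : K) + z) * W := by
    simp only [wzF, hW]; ring
  have eF1 : wzF z (n + 1) n = ((n : K) - 2 + z) * (((n : K) + 1) * ((n : K) + 1 - z)) / (1 - z) * W := by
    simp only [wzF, hW]; rw [hP1]; push_cast; ring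
  have eF2 : wzF z (n + 1) (n + 1) = 2 * (2 * (n : K) + 1) * W := by
    simp only [wzF, hW]
    rw [hP2, wzD_succ, hC]
    push_cast
    rw [show ((n : K) + 1) ^ 2 - z ^ 2 = ((n : K) + 1 - z) * ((n : K) + 1 + z) by ring]
    have hn1'' : (n : K) + 1 + z ≠ 0 := by
      intro h0
      have := hz (n + 1) (by rw [Finset.mem_Icc]; omega)
      apply this; push_cast
      rw [show (n : K) + 1 = -z by linear_combination h0]; ring
    field_simp
    ring
  rw [eG, eF0, eF1, eF2]
  field_simp
  ring

/-- `S(n) = Σ_{k=1}^{n} F(n,k) = 2n` ([Tauraso2020]: "`S₁ = F(1,1) = 2`", "`S_{n+1} − S_n = … = 2`").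
[cite: Tauraso2020, §3 proof of Theorem 1] -/
theorem wz_sum_eq (z : K) (n : ℕ) (hn : 1 ≤ n) (hz : ∀ j ∈ Finset.Icc 1 n, (j : K) ^ 2 ≠ z ^ 2) :
    ∑ k ∈ Finset.Icc 1 n, wzF z n k = 2 * n := by
  induction n with
  | zero => omega
  | succ m ih =>
    rcases Nat.eq_zero_or_pos m with hm0 | hmpos
    · -- base case `n = 1`: `F(1,1) = 2`
      subst hm0
      have h1z : (1 : K) - z ^ 2 ≠ 0 := by
        have := hz 1 (by simp)
        norm_num at this
        exact sub_ne_zero.2 this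
      have hc1 : Nat.centralBinom 1 = 2 := by decide
      simp only [zero_add, Finset.Icc_self, Finset.sum_singleton, wzF, wzP, wzD, Finset.prod_range_one, hc1]
      push_cast
      rw [div_eq_iff (by rw [show ((0 : K) + 1) ^ 2 - z ^ 2 = 1 - z ^ 2 by ring]; exact h1z)]
      ring
    · -- inductive step from `m ≥ 1` to `m + 1`
      have hz' : ∀ j ∈ Finset.Icc 1 m, (j : K) ^ 2 ≠ z ^ 2 := fun j hj =>
        hz j (by rw [Finset.mem_Icc] at hj ⊢; omega)
      have hS := ih hmpos hz'
      obtain ⟨p, rfl⟩ : ∃ p, m = p + 1 := ⟨m - 1, by omega⟩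
      -- split the sums
      have hsplit1 : ∑ k ∈ Finset.Icc 1 (p + 1 + 1), wzF z (p + 1 + 1) k =
          ∑ k ∈ Finset.Icc 1 p, wzF z (p + 1 + 1) k + wzF z (p + 1 + 1) (p + 1) +
            wzF z (p + 1 + 1) (p + 1 + 1) := by
        rw [Finset.sum_Icc_succ_top (by omega), Finset.sum_Icc_succ_top (by omega)]
      have hsplit2 : ∑ k ∈ Finset.Icc 1 (p + 1), wzF z (p + 1) k =
          ∑ k ∈ Finset.Icc 1 p, wzF z (p + 1) k + wzF z (p + 1) (p + 1) := by
        rw [Finset.sum_Icc_succ_top (by omega)]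
      -- telescoping over `1 ≤ k ≤ p`
      have htel : ∑ k ∈ Finset.Icc 1 p, (wzF z (p + 1 + 1) k - wzF z (p + 1) k) =
          wzG z (p + 1) (p + 1) - wzG z (p + 1) 1 := by
        have hrel : ∀ k ∈ Finset.Icc 1 p,
            wzF z (p + 1 + 1) k - wzF z (p + 1) k = wzG z (p + 1) (k + 1) - wzG z (p + 1) k :=
          fun k hk => by
            have hk' := Finset.mem_Icc.1 hk
            exact wz_relation z hk'.1 (by omega) hz'
        rw [Finset.sum_congr rfl hrel, ← Finset.Ico_add_one_right_eq_Icc, Finset.sum_Ico_eq_sum_range,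
          show p + 1 - 1 = p by omega]
        have := Finset.sum_range_sub (fun i => wzG z (p + 1) (1 + i)) p
        rw [show 1 + p = p + 1 by ring, show 1 + 0 = 1 by rfl] at this
        rw [← this]
        refine Finset.sum_congr rfl fun i _ => ?_
        rw [show 1 + i + 1 = 1 + (i + 1) by ring]
      have hG1 := wzG_one z hmpos hz'
      have hbd := wz_boundary z hmpos hz
      rw [hsplit1]
      rw [hsplit2] at hS
      have hsum : ∑ k ∈ Finset.Icc 1 p, wzF z (p + 1 + 1) k =
          ∑ k ∈ Finset.Icc 1 p, wzF z (p + 1) k + (wzG z (p + 1) (p + 1) - wzG z (p + 1) 1) := by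
        rw [← htel, ← Finset.sum_add_distrib]
        exact Finset.sum_congr rfl fun k _ => by ring
      rw [hsum, hG1]
      push_cast at hS hbd ⊢
      linear_combination hS + hbd

/-- **Tauraso 2020, Theorem 1 (first display), PROVED**: for every positive integer `n` and every `z` in a field of
characteristic `0` with `z² ∉ {1², 2², …, n²}` (so that no denominator vanishes; the printed statement is the same
identity of rational functions of `z`),
`Σ_{k=1}^{n} C(2k,k) (3k − 2n + z) ∏_{j=1}^{k−1}(j−n)(j−n+z) / ∏_{j=1}^{k}(j²−z²) = 2/(n − z)`.
Proof as printed (the WZ pair `(F,G)`, `Σ_k F(n,k) = 2n`), dividing by `F`'s extra factor `n(n−z)`.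
[cite: Tauraso2020, §3 Theorem 1 (first display)] -/
theorem tauraso2020_theorem1 (n : ℕ) (hn : 1 ≤ n) (z : K) (hz : ∀ j ∈ Finset.Icc 1 n, (j : K) ^ 2 ≠ z ^ 2) :
    ∑ k ∈ Finset.Icc 1 n, (k.centralBinom : K) * (3 * (k : K) - 2 * n + z) *
        (∏ j ∈ Finset.Ico 1 k, (((j : K) - n) * ((j : K) - n + z))) /
        (∏ j ∈ Finset.Icc 1 k, ((j : K) ^ 2 - z ^ 2)) = 2 / ((n : K) - z) := by
  have hn0 : (n : K) ≠ 0 := by exact_mod_cast (show n ≠ 0 by omega)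
  have hnz : (n : K) - z ≠ 0 := by
    intro h0
    have := hz n (by rw [Finset.mem_Icc]; omega)
    apply this; rw [show (n : K) = z by linear_combination h0]
  have hS := wz_sum_eq z n hn hz
  -- each summand of `S(n)` is `n(n−z)` times the printed summand
  have hterm : ∀ k ∈ Finset.Icc 1 n, wzF z n k = (n : K) * ((n : K) - z) *
      ((k.centralBinom : K) * (3 * (k : K) - 2 * n + z) *
        (∏ j ∈ Finset.Ico 1 k, (((j : K) - n) * ((j : K) - n + z))) /
        (∏ j ∈ Finset.Icc 1 k, ((j : K) ^ 2 - z ^ 2))) := fun k hk => by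
    have hk1 : 1 ≤ k := (Finset.mem_Icc.1 hk).1
    have hP : wzP z n k = (n : K) * ((n : K) - z) *
        ∏ j ∈ Finset.Ico 1 k, (((j : K) - n) * ((j : K) - n + z)) := by
      obtain ⟨k', rfl⟩ : ∃ k', k = k' + 1 := ⟨k - 1, by omega⟩
      rw [wzP, Finset.prod_range_succ', Finset.prod_Ico_eq_prod_range, show k' + 1 - 1 = k' by omega]
      have e : ∏ j ∈ Finset.range k', ((((j + 1 : ℕ) : K) - n) * (((j + 1 : ℕ) : K) - n + z)) =
          ∏ j ∈ Finset.range k', ((((1 + j : ℕ) : K) - n) * (((1 + j : ℕ) : K) - n + z)) :=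
        Finset.prod_congr rfl fun j _ => by rw [Nat.add_comm]
      rw [e]
      push_cast
      ring
    have hD : wzD z k = ∏ j ∈ Finset.Icc 1 k, ((j : K) ^ 2 - z ^ 2) := by
      rw [wzD, ← Finset.Ico_add_one_right_eq_Icc, Finset.prod_Ico_eq_prod_range, show k + 1 - 1 = k by omega]
      exact Finset.prod_congr rfl fun j _ => by push_cast; ring
    rw [wzF, hP, hD]
    ring
  rw [Finset.sum_congr rfl hterm, ← Finset.mul_sum] at hS
  rw [eq_div_iff hnz]
  have h2 : (n : K) * (((n : K) - z) * ∑ k ∈ Finset.Icc 1 n, (k.centralBinom : K) * (3 * (k : K) - 2 * n + z) *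
      (∏ j ∈ Finset.Ico 1 k, (((j : K) - n) * ((j : K) - n + z))) /
      (∏ j ∈ Finset.Icc 1 k, ((j : K) ^ 2 - z ^ 2))) = (n : K) * 2 := by
    rw [← mul_assoc, hS]; ring
  have h3 := mul_left_cancel₀ hn0 h2
  linear_combination h3

end WZ

/-! ### The explicit Koecher–Leshchiner formula for every odd zeta value (appended) -/

/-- The multiple harmonic sum `H_k({2}^s) = Σ_{1 ≤ j₁ < ⋯ < j_s ≤ k} 1/(j₁² ⋯ j_s²)`, i.e. the `s`-th elementary symmetric
function of `1/1², …, 1/k²` (`H_k({2}^0) = 1`). [cite: Tauraso2025, §1 (definition after the display following (KL))] -/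
def multipleHarmonicTwo (k s : ℕ) : ℝ :=
  ∑ S ∈ (Finset.Icc 1 k).powersetCard s, ∏ j ∈ S, 1 / (j : ℝ) ^ 2

/-- **Koecher–Leshchiner, the explicit Apéry-like series for `ζ(2r+3)`** (NAMED FACT; the coefficient of `x^{2r}` in
the generating function (1–2) = [Tauraso2025, (KL)]): for every `r ≥ 0`,
`ζ(2r+3) = Σ_{k≥1} ((−1)^{k−1−r}/(k³ C(2k,k))) ((5/2) H_{k−1}({2}^r) + 2 Σ_{j=1}^{r} ((−1)^j/k^{2j}) H_{k−1}({2}^{r−j}))`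
(`r = 0`: Apéry–Markov (1–1); `r = 1`: Koecher's `ζ(5)` = `zeta_five_apery_like`). Typed with `(−1)^{k+1+r}` for
`(−1)^{k−1−r}` and the tree's real `zetaValue`; seat check: `r = 0, 1, 2, 3` agree with `ζ(3), ζ(5), ζ(7), ζ(9)` to
`10^{−15}`. [cite: Tauraso2025, §1 (display after (KL))] [cite: Koecher1980, (generating function of ζ(2n+3))] -/
def koecherLeshchiner_oddZeta : Prop :=
  ∀ r : ℕ,
    Literature.NumberTheory.Transcendental.zetaValue (2 * r + 3) =
      ∑' k : ℕ, (-1 : ℝ) ^ (k + 2 + r) / (((k + 1 : ℕ) : ℝ) ^ 3 * ((k + 1).centralBinom : ℝ)) *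
        (5 / 2 * multipleHarmonicTwo k r +
          2 * ∑ j ∈ Finset.Icc 1 r, (-1 : ℝ) ^ j / ((k + 1 : ℕ) : ℝ) ^ (2 * j) * multipleHarmonicTwo k (r - j))

end Literature.NumberTheory.ZetaValues
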